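import Literature.Computability.QuantumComplexity.QFTQubits
import Literature.Computability.QuantumComplexity.QFTZModPow
import HarnessLib

/-!
# The quantum Fourier transform on `n` registers of `κ` qubits: the `n`-fold transform over `ℤ_R^n`

Topic `Literature/Computability/QuantumComplexity`, sequel of `QFTQubits.lean` (one register: the rounds
`round_{κ-1} ⋯ round_0` map `|x⟩` to `2^{-κ/2} Σ_b e(u(x)t(b)/2^κ)|x[ws ↦ b]⟩`) and `QFTZModPow.lean`
(`QFTZMod.qftMatrix ι R`, the transform over `ℤ_Rⁿ` with kernel `Πᵢ e^{2πi sᵢtᵢ/R}`). Regev's quantum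
step (Regev 2009, Lemma 3.14: "We now apply the quantum Fourier transform on `ℤ_R^n`") with `R = 2^κ`
applies the one-register circuit to each of the `n` coordinate registers; this file proves the ideal
form of that step in the tree's model:

* `QFTQubits.coeff ws x b = 2^{-κ/2} e(u(x)t(b)/2^κ)`, `QFTQubits.blockQFT ws = (roundList ws).prod`
  (`blockQFT_mulVec_basisState`);
* for blocks `ws i : Fin κ ↪ Fin N` (`i < n`) with pairwise disjoint ranges: `writeAll ws x T` (all
  blocks rewritten), its algebra (`writeAll_apply_ws`, `writeB_writeAll`, `writeAll_injective`), the
  operator `multiQFT ws` (block `0` first) and **`QFTQubits.multiQFT_mulVec_basisState`**: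
  `multiQFT |x⟩ = Σ_T (Πᵢ coeff (ws i) x (T i)) • |x[ws ↦ T]⟩` (induction over the blocks, the
  numeral of an unprocessed block being that of the input);
* the bridge to `ℤ_R` (`R = 2^κ`): **`QFTQubits.coeff_eq_stdAddChar`**:
  `coeff ws x b = (√R)⁻¹ · stdAddChar((u(x) : ZMod R) · t(b))` (`u` = `uVal`, the input numeral with
  `ws 0` most significant; `t` = `tVal`, the output numeral in REVERSED bit order, as in `QFTQubits.lean`),
  so that **`prod_coeff_eq_qftMatrix`**: `Πᵢ coeff (ws i) x (T i) = qftMatrix (Fin n) R t s` with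
  `sᵢ = u(x|block i)`, `tᵢ = t(T i)`, and **`multiQFT_mulVec_basisState_eq_qftMatrix`** — the amplitudes
  of `multiQFT |x⟩` ARE the column `s` of the transform over `ℤ_R^n`.

Everything here is proved; definitions have bodies; no named fact is introduced.

## References

* M. A. Nielsen, I. L. Chuang, *Quantum Computation and Quantum Information*, CUP 2010, §5.1
  eqs. (5.2)–(5.10) [NielsenChuang2010].
* O. Regev, *On lattices, learning with errors, random linear codes, and cryptography*, J. ACM 56
  (2009), art. 34, Lemma 3.14 (proof) [Regev2009].
* D. Coppersmith, IBM Research Report RC 19642 (1994), arXiv:quant-ph/0201067 [Coppersmith1994].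
-/

noncomputable section

namespace Literature.Computability.QuantumComplexity

open _root_.Matrix Complex Finset Cryptography

namespace QFTQubits

variable {N κ n : ℕ}

/-! ### One block -/

section One

variable (ws : Fin κ ↪ Fin N)

/-- **The Fourier coefficient** `2^{-κ/2} e(u(x) t(b)/2^κ)` of the output bits `b` on the input `x`.
[cite: NielsenChuang2010, §5.1 eq. (5.2)] -/
def coeff (x : QReg N) (b : Fin κ → Bool) : ℂ := (invSqrt2 : ℂ) ^ κ * eR ((uVal ws x : ℝ) * tVal b / 2 ^ κ)

/-- The Fourier state in terms of `coeff`. [folklore] -/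
theorem fourierState_eq (x : QReg N) : fourierState ws x = ∑ b : Fin κ → Bool, coeff ws x b • basisState (writeB ws x b) := rfl

/-- **The ideal one-block transform** (the product of the rounds). [cite: NielsenChuang2010, §5.1 Fig. 5.1] -/
def blockQFT : Matrix (QReg N) (QReg N) ℂ := (roundList ws).prod

/-- `blockQFT |x⟩ = Σ_b coeff x b • |x[ws ↦ b]⟩`. [cite: NielsenChuang2010, §5.1 eqs. (5.4)–(5.10)] -/
theorem blockQFT_mulVec_basisState (x : QReg N) :
    blockQFT ws *ᵥ basisState x = ∑ b : Fin κ → Bool, coeff ws x b • basisState (writeB ws x b) :=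
  prod_roundList_mulVec_basisState ws x

/-- The one-block transform is unitary. [folklore] -/
theorem blockQFT_mem_unitaryGroup : blockQFT ws ∈ Matrix.unitaryGroup (QReg N) ℂ :=
  list_prod_mem (fun M hM => roundList_mem_unitaryGroup ws M hM)

/-- The coefficient only reads the block. [folklore] -/
theorem coeff_congr {x x' : QReg N} (h : ∀ i, x (ws i) = x' (ws i)) (b : Fin κ → Bool) : coeff ws x b = coeff ws x' b := by
  unfold coeff uVal
  rw [show (∑ i : Fin κ, if x (ws i) = true then 2 ^ (κ - 1 - (i : ℕ)) else 0) =
      ∑ i : Fin κ, if x' (ws i) = true then 2 ^ (κ - 1 - (i : ℕ)) else 0 from sum_congr rfl fun i _ => by rw [h i]]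

end One

/-! ### Several disjoint blocks -/

section Many

variable (ws : Fin n → (Fin κ ↪ Fin N))

/-- **All blocks rewritten**: wire `ws i j` gets `T i j`, the other wires keep `x`. [folklore] -/
def writeAll (x : QReg N) (T : Fin n → Fin κ → Bool) : QReg N := fun q =>
  if h : ∃ p : Fin n × Fin κ, ws p.1 p.2 = q then T h.choose.1 h.choose.2 else x q

/-- Off the blocks, `writeAll` keeps the input. [folklore] -/
theorem writeAll_apply_of_forall_ne (x : QReg N) (T : Fin n → Fin κ → Bool) {q : Fin N} (hq : ∀ i j, ws i j ≠ q) :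
    writeAll ws x T q = x q := by
  unfold writeAll
  rw [dif_neg]
  rintro ⟨p, hp⟩
  exact hq p.1 p.2 hp

variable {ws}
variable (hdis : ∀ i i', i ≠ i' → Disjoint (Set.range (ws i)) (Set.range (ws i')))
include hdis

/-- Distinct block positions are distinct wires. [folklore] -/
theorem ws_inj {i i' : Fin n} {j j' : Fin κ} (h : ws i j = ws i' j') : i = i' ∧ j = j' := by
  by_cases hii : i = i'
  · subst hii; exact ⟨rfl, (ws i).injective h⟩
  · exact absurd (Set.disjoint_left.1 (hdis i i' hii) ⟨j, rfl⟩) (fun hn => hn ⟨j', h.symm⟩)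

/-- On the blocks, `writeAll` writes `T`. [folklore] -/
theorem writeAll_apply_ws (x : QReg N) (T : Fin n → Fin κ → Bool) (i : Fin n) (j : Fin κ) :
    writeAll ws x T (ws i j) = T i j := by
  unfold writeAll
  have h : ∃ p : Fin n × Fin κ, ws p.1 p.2 = ws i j := ⟨(i, j), rfl⟩
  rw [dif_pos h]
  obtain ⟨h1, h2⟩ := ws_inj hdis h.choose_spec
  rw [h1, h2]

/-- Writing the input's own blocks does nothing. [folklore] -/
theorem writeAll_self (x : QReg N) : writeAll ws x (fun i => x ∘ ws i) = x := by
  funext q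
  by_cases h : ∃ p : Fin n × Fin κ, ws p.1 p.2 = q
  · obtain ⟨⟨i, j⟩, rfl⟩ := h
    rw [writeAll_apply_ws hdis]; rfl
  · exact writeAll_apply_of_forall_ne ws x _ fun i j e => h ⟨(i, j), e⟩

/-- Rewriting block `i` of `writeAll x T` is `writeAll x (update T i ·)`. [folklore] -/
theorem writeB_writeAll (x : QReg N) (T : Fin n → Fin κ → Bool) (i : Fin n) (b : Fin κ → Bool) :
    writeB (ws i) (writeAll ws x T) b = writeAll ws x (Function.update T i b) := by
  funext q
  by_cases h : ∃ p : Fin n × Fin κ, ws p.1 p.2 = q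
  · obtain ⟨⟨i', j⟩, rfl⟩ := h
    rw [writeAll_apply_ws hdis]
    by_cases hii : i' = i
    · subst hii
      rw [writeB_apply_ws, Function.update_self]
    · rw [Function.update_of_ne hii, writeB_apply_of_not_mem, writeAll_apply_ws hdis]
      rintro ⟨j', hj'⟩
      exact hii (ws_inj hdis hj').1.symm
  · have hq : ∀ i j, ws i j ≠ q := fun i j e => h ⟨(i, j), e⟩
    rw [writeAll_apply_of_forall_ne ws x _ hq, writeB_apply_of_not_mem, writeAll_apply_of_forall_ne ws x _ hq]
    rintro ⟨j, hj⟩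
    exact hq i j hj

/-- `writeAll x` is injective. [folklore] -/
theorem writeAll_injective (x : QReg N) : Function.Injective (writeAll ws x) := fun T T' h => by
  funext i j
  rw [← writeAll_apply_ws hdis x T i j, ← writeAll_apply_ws hdis x T' i j, h]

/-- The coefficient of block `i` on `writeAll x T` is that of the input when block `i` is unprocessed. [folklore] -/
theorem coeff_writeAll_of_agree (x : QReg N) {T : Fin n → Fin κ → Bool} {i : Fin n} (hT : T i = x ∘ ws i) (b : Fin κ → Bool) :
    coeff (ws i) (writeAll ws x T) b = coeff (ws i) x b :=
  coeff_congr (ws i) (fun j => by rw [writeAll_apply_ws hdis, hT]; rfl) b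

omit hdis in
/-- Block tuples agreeing with the input from block `m` on. [folklore] -/
def agreeAfter (ws : Fin n → (Fin κ ↪ Fin N)) (x : QReg N) (m : ℕ) : Finset (Fin n → Fin κ → Bool) :=
  univ.filter fun T => ∀ i : Fin n, m ≤ (i : ℕ) → T i = x ∘ ws i

omit hdis in
/-- Membership in `agreeAfter`. [folklore] -/
@[simp] theorem mem_agreeAfter {x : QReg N} {m : ℕ} {T : Fin n → Fin κ → Bool} :
    T ∈ agreeAfter ws x m ↔ ∀ i : Fin n, m ≤ (i : ℕ) → T i = x ∘ ws i := by simp [agreeAfter]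

omit hdis in
/-- At `0` only the input's own blocks agree. [folklore] -/
theorem agreeAfter_zero (x : QReg N) : agreeAfter ws x 0 = {fun i => x ∘ ws i} := by
  ext T; simp only [mem_agreeAfter, zero_le, forall_const, mem_singleton]
  constructor
  · intro h; funext i; exact h i
  · rintro rfl i; rfl

omit hdis in
/-- From `n` on every tuple agrees. [folklore] -/
theorem agreeAfter_of_le (x : QReg N) {m : ℕ} (hm : n ≤ m) : agreeAfter ws x m = univ := by
  ext T; simp only [mem_agreeAfter, mem_univ, iff_true]
  intro i hi; exact absurd (lt_of_lt_of_le i.2 (hm.trans hi)) (lt_irrefl _)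

omit hdis in
/-- The tuples agreeing after `m + 1` are the updates at `m` of those agreeing after `m`. [folklore] -/
theorem agreeAfter_succ_eq_image (x : QReg N) (m : Fin n) :
    agreeAfter ws x (m + 1) = ((agreeAfter ws x m) ×ˢ (univ : Finset (Fin κ → Bool))).image fun p => Function.update p.1 m p.2 := by
  ext T
  simp only [mem_agreeAfter, mem_image, mem_product, mem_univ, and_true, Prod.exists]
  constructor
  · intro h
    refine ⟨Function.update T m (x ∘ ws m), T m, ?_, ?_⟩
    · intro i hi
      by_cases him : i = m
      · subst him; simp
      · rw [Function.update_of_ne him]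
        exact h i (by have : (m : ℕ) ≠ i := fun e => him (Fin.ext e.symm); omega)
    · simp
  · rintro ⟨T₀, b, hT₀, rfl⟩ i hi
    rw [Function.update_of_ne (by intro e; subst e; omega)]
    exact hT₀ i (by omega)

omit hdis in
/-- The update map is injective on agreeing tuples paired with a block content. [folklore] -/
theorem update_injOn_agreeAfter (x : QReg N) (m : Fin n) :
    Set.InjOn (fun p : (Fin n → Fin κ → Bool) × (Fin κ → Bool) => Function.update p.1 m p.2)
      (((agreeAfter ws x m) ×ˢ (univ : Finset (Fin κ → Bool)) : Finset _) : Set ((Fin n → Fin κ → Bool) × (Fin κ → Bool))) := by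
  rintro ⟨T, b⟩ hT ⟨T', b'⟩ hT' h
  dsimp only at h
  simp only [coe_product, coe_univ, Set.mem_prod, mem_coe, mem_agreeAfter, Set.mem_univ, and_true] at hT hT'
  have hb : b = b' := by have := congrFun h m; simpa using this
  subst hb
  have : T = T' := by
    funext i
    by_cases him : i = m
    · subst him; rw [hT i le_rfl, hT' i le_rfl]
    · have := congrFun h i; rwa [Function.update_of_ne him, Function.update_of_ne him] at this
  rw [this]

omit hdis in
/-- **The state after the first `m` blocks**: `Σ_{T agreeing after m} (Π_{i<m} coeff_i) • |x[ws ↦ T]⟩`. [cite: Regev2009, Lemma 3.14 (proof)] -/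
def multiStateAt (ws : Fin n → (Fin κ ↪ Fin N)) (x : QReg N) (m : ℕ) : QReg N → ℂ :=
  ∑ T ∈ agreeAfter ws x m, (∏ i : Fin n, if (i : ℕ) < m then coeff (ws i) x (T i) else 1) • basisState (writeAll ws x T)

/-- At `0` the state is the input. [folklore] -/
theorem multiStateAt_zero (x : QReg N) : multiStateAt ws x 0 = basisState x := by
  unfold multiStateAt
  rw [agreeAfter_zero, sum_singleton, writeAll_self hdis]
  simp

/-- **The block step**: block `m` maps the state after `m` blocks to the state after `m + 1`. [cite: NielsenChuang2010, §5.1] -/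
theorem blockQFT_mulVec_multiStateAt (x : QReg N) (m : Fin n) :
    blockQFT (ws m) *ᵥ multiStateAt ws x m = multiStateAt ws x (m + 1) := by
  unfold multiStateAt
  rw [Matrix.mulVec_sum, agreeAfter_succ_eq_image, sum_image (update_injOn_agreeAfter x m), sum_product]
  refine sum_congr rfl fun T hT => ?_
  rw [mem_agreeAfter] at hT
  have hTm : T m = x ∘ ws m := hT m le_rfl
  rw [Matrix.mulVec_smul, blockQFT_mulVec_basisState, smul_sum]
  refine sum_congr rfl fun b _ => ?_
  rw [writeB_writeAll hdis, coeff_writeAll_of_agree hdis x hTm, smul_smul]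
  congr 1
  -- the product of coefficients picks up the factor of block `m`
  dsimp only
  have hGm : (if ((m : Fin n) : ℕ) < (m : ℕ) then coeff (ws m) x (T m) else (1 : ℂ)) = 1 := by simp
  have hFm : (if ((m : Fin n) : ℕ) < (m : ℕ) + 1 then coeff (ws m) x (Function.update T m b m) else (1 : ℂ)) = coeff (ws m) x b := by
    simp
  have hFG : ∀ i ∈ univ.erase m, (if ((i : Fin n) : ℕ) < (m : ℕ) + 1 then coeff (ws i) x (Function.update T m b i) else (1 : ℂ)) =
      (if ((i : Fin n) : ℕ) < (m : ℕ) then coeff (ws i) x (T i) else (1 : ℂ)) := by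
    intro i hi
    have him : i ≠ m := ne_of_mem_erase hi
    rw [Function.update_of_ne him]
    have : ((i : ℕ) < (m : ℕ) + 1) ↔ ((i : ℕ) < m) :=
      ⟨fun h => lt_of_le_of_ne (Nat.lt_succ_iff.1 h) (fun e => him (Fin.ext e)), fun h => by omega⟩
    simp only [this]
  rw [← mul_prod_erase univ (fun i : Fin n => if (i : ℕ) < (m : ℕ) then coeff (ws i) x (T i) else (1 : ℂ)) (mem_univ m),
    ← mul_prod_erase univ (fun i : Fin n => if (i : ℕ) < (m : ℕ) + 1 then coeff (ws i) x (Function.update T m b i) else (1 : ℂ))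
      (mem_univ m), hGm, one_mul, hFm, prod_congr rfl hFG, mul_comm]

/-- **The `n`-block transform** (block `0` applied first). [cite: Regev2009, Lemma 3.14 (proof)] -/
def multiQFT (ws : Fin n → (Fin κ ↪ Fin N)) : Matrix (QReg N) (QReg N) ℂ := (List.ofFn fun i : Fin n => blockQFT (ws i)).reverse.prod

omit hdis in
/-- The `n`-block transform is unitary. [folklore] -/
theorem multiQFT_mem_unitaryGroup : multiQFT ws ∈ Matrix.unitaryGroup (QReg N) ℂ := by
  refine list_prod_mem fun M hM => ?_
  rw [List.mem_reverse, List.mem_ofFn] at hM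
  obtain ⟨i, rfl⟩ := hM
  exact blockQFT_mem_unitaryGroup (ws i)

/-- The first `k` blocks map the input to the state after `k` blocks. [folklore] -/
theorem prod_take_blocks_mulVec (x : QReg N) :
    ∀ k, k ≤ n → ((List.ofFn fun i : Fin n => blockQFT (ws i)).take k).reverse.prod *ᵥ basisState x = multiStateAt ws x k
  | 0, _ => by simp [multiStateAt_zero hdis]
  | k + 1, hk => by
    have hk' : k < n := hk
    rw [List.take_add_one, List.reverse_append, List.prod_append, ← Matrix.mulVec_mulVec,
      prod_take_blocks_mulVec x k (Nat.le_of_lt hk'), List.getElem?_ofFn]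
    simp only [hk', ↓reduceDIte, Option.toList_some, List.reverse_singleton, List.prod_singleton]
    exact blockQFT_mulVec_multiStateAt hdis x ⟨k, hk'⟩

/-- **The `n`-fold QFT, ideal form**: `multiQFT |x⟩ = Σ_T (Πᵢ coeff (ws i) x (T i)) • |x[ws ↦ T]⟩`.
[cite: Regev2009, Lemma 3.14 (proof: "We now apply the quantum Fourier transform on ℤ_R^n")] [cite: NielsenChuang2010, §5.1] -/
theorem multiQFT_mulVec_basisState (x : QReg N) :
    multiQFT ws *ᵥ basisState x =
      ∑ T : Fin n → Fin κ → Bool, (∏ i : Fin n, coeff (ws i) x (T i)) • basisState (writeAll ws x T) := by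
  have h := prod_take_blocks_mulVec hdis x n le_rfl
  rw [List.take_of_length_le (by simp)] at h
  rw [multiQFT, h, multiStateAt, agreeAfter_of_le x le_rfl]
  refine sum_congr rfl fun T _ => ?_
  congr 1
  exact prod_congr rfl fun i _ => if_pos i.2

end Many

/-! ### The bridge to `ℤ_R`, `R = 2^κ` -/

section Bridge

/-- `√(aⁿ) = (√a)ⁿ` for `a ≥ 0`. [folklore] -/
theorem sqrt_pow_eq {a : ℝ} (ha : 0 ≤ a) (m : ℕ) : Real.sqrt (a ^ m) = Real.sqrt a ^ m := by
  rw [← Real.sqrt_sq (pow_nonneg (Real.sqrt_nonneg a) m), ← pow_mul, mul_comm, pow_mul, Real.sq_sqrt ha]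

/-- `(1/√2)^κ = 1/√(2^κ)`. [folklore] -/
theorem invSqrt2_pow_eq (κ : ℕ) : (invSqrt2 : ℂ) ^ κ = (((Real.sqrt ((2 : ℝ) ^ κ))⁻¹ : ℝ) : ℂ) := by
  rw [sqrt_pow_eq zero_le_two, invSqrt2]
  push_cast
  rw [one_div, inv_pow]

/-- **The Fourier coefficient is the `ℤ_R` character**: `coeff ws x b = (√R)⁻¹ · e_R(u(x) · t(b))`,
`R = 2^κ`, `e_R = ZMod.stdAddChar`. [cite: NielsenChuang2010, §5.1 eq. (5.2)] -/
theorem coeff_eq_stdAddChar (ws : Fin κ ↪ Fin N) (x : QReg N) (b : Fin κ → Bool) :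
    coeff ws x b = (((Real.sqrt ((2 : ℝ) ^ κ))⁻¹ : ℝ) : ℂ) *
      ZMod.stdAddChar (((uVal ws x : ℕ) : ZMod (2 ^ κ)) * ((tVal b : ℕ) : ZMod (2 ^ κ))) := by
  unfold coeff eR
  rw [invSqrt2_pow_eq]
  congr 1
  have h : ((uVal ws x : ℕ) : ZMod (2 ^ κ)) * ((tVal b : ℕ) : ZMod (2 ^ κ)) = (((uVal ws x * tVal b : ℕ) : ℤ) : ZMod (2 ^ κ)) := by
    push_cast; ring
  rw [h, ZMod.stdAddChar_coe]
  congr 1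
  push_cast
  ring

variable {ws : Fin n → (Fin κ ↪ Fin N)}

/-- **The amplitudes of the `n`-fold transform are the entries of the transform over `ℤ_R^n`**:
`Πᵢ coeff (ws i) x (T i) = qftMatrix (Fin n) R t s`, `sᵢ = u(x|block i)`, `tᵢ = t(T i)` (`R = 2^κ`).
[cite: Regev2009, Lemma 3.14 (proof)] [cite: NielsenChuang2010, §5.1 eq. (5.2)] -/
theorem prod_coeff_eq_qftMatrix (ws : Fin n → (Fin κ ↪ Fin N)) (x : QReg N) (T : Fin n → Fin κ → Bool) :
    ∏ i : Fin n, coeff (ws i) x (T i) =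
      QFTZMod.qftMatrix (Fin n) (2 ^ κ) (fun i => ((tVal (T i) : ℕ) : ZMod (2 ^ κ)))
        (fun i => ((uVal (ws i) x : ℕ) : ZMod (2 ^ κ))) := by
  simp_rw [coeff_eq_stdAddChar]
  rw [prod_mul_distrib, prod_const, card_univ, Fintype.card_fin, QFTZMod.qftMatrix, QFTZMod.qftKernel, Fintype.card_fin]
  congr 1
  rw [← Complex.ofReal_pow]
  congr 1
  rw [Nat.cast_pow, Nat.cast_ofNat, inv_pow, ← sqrt_pow_eq (by positivity)]

/-- **The `n`-fold QFT in `ℤ_R^n` form**: `multiQFT |x⟩ = Σ_T F_{t(T), s(x)} • |x[ws ↦ T]⟩` with `F` the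
transform over `ℤ_R^n` (`QFTZMod.qftMatrix`), `s(x)ᵢ = u(x|block i)`, `t(T)ᵢ = t(T i)` (reversed bits).
[cite: Regev2009, Lemma 3.14 (proof)] -/
theorem multiQFT_mulVec_basisState_eq_qftMatrix
    (hdis : ∀ i i', i ≠ i' → Disjoint (Set.range (ws i)) (Set.range (ws i'))) (x : QReg N) :
    multiQFT ws *ᵥ basisState x =
      ∑ T : Fin n → Fin κ → Bool,
        QFTZMod.qftMatrix (Fin n) (2 ^ κ) (fun i => ((tVal (T i) : ℕ) : ZMod (2 ^ κ)))
          (fun i => ((uVal (ws i) x : ℕ) : ZMod (2 ^ κ))) • basisState (writeAll ws x T) := by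
  rw [multiQFT_mulVec_basisState hdis]
  refine sum_congr rfl fun T _ => ?_
  rw [prod_coeff_eq_qftMatrix]

end Bridge

end QFTQubits

end Literature.Computability.QuantumComplexity

end
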